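import Summits.BirchSwinnertonDyer.BirchSwinnertonDyer.Theorems.Rank1ResidualJetKolyvaginClassStringent
import Summits.BirchSwinnertonDyer.BirchSwinnertonDyer.Theorems.KatoDescentTamePotSupersingularJetchevIrreducibleReadingThm52Bricks
import HarnessLib

/-!
# Crux `JetchevIrreducibleReadingByName` (item 20165, shared K8-t′ / K9) and crux `WildJetchevBoundAtP` (item 19941, K9):
# the completion-layer gap `h49str` (Jetchev 2008 Prop. 4.9 proper — `loc_v c_k(c)` is STRINGENT at every place `v ∤ c`)
# ON AN IRREDUCIBLE ROW, from [GZ86 III (3.1)] in the receptacle form — the irreducible port of bsd-jet pv-1 g7's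
# K-GAP-2 theorem `JET.localization_kolyvaginClass_mem_stringentFamily_of_GZ31` (step C3 of the receptacle route:
# strong Milne I.3.8 at a bad place + `E⁰(K̄_v) ∩ E(K_v) = E₀(K_v)` + Gross 6.2 (1) upgraded to the connected Kummer
# condition; uniform in `v ∣ p` / `v ∤ p`, no Lemma 4.3) — seat `bsd-potss-k9-c4` g9; route-free; `--supports 20165`,
# helper; nothing booked, no item closed, BSD is not proved by any of this

WHY. On the irreducible H63 line of the two cruxes (k8t-c4 g8/g9 → k9-c4 g8/g9) the stringent membership of the
Kolyvagin classes at the carrier places (`h49str`, the `q = p` one being exactly the «new argument at v ∣ 3» the K9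
route docstring asks for) was the ONE completion-layer KERNEL GAP left after bsd-jet's 2026-08-27 closures. pv-1 g7's
C3 derives it, for the TOWER rows, from the frame's own `hGZ` ([GZ86 III (3.1)] schema, already a displayed named-print
binder) + `hcop′` + the two Gross §3 CM facts; its only uses of mod-`p` surjectivity are the admissibility
`E(K[m])[p] = 0` and the Kummer membership, both of which have IRREDUCIBLE twins in the tree (k8t-c4 g8's bricks,
p507503: irreducibility + `p ∣ N_E` ⇒ `p` unramified in `K` ⇒ no `p`-torsion over ring class fields of conductor prime
to `p`). WHAT IS PROVED. §1 `localization_kolyvaginClass_mem_kummerSelmerStructure_of_GZ31_of_irreducible_kolyvagin`: k8t-c4 g8's Kummer-membership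
brick with `hGZ` displayed in the GUARDED shape (read-1's `HGZKolyvagin`: `∀ m` square-free with Zhang–Kolyvagin prime factors —
the unguarded `∀ m` closure is SATISFIABILITY-UNVERIFIED, bsd-jet read-1 ADD-9 ANNEX-5 §2; the brick consumes the schema at the
divisors of `c` only). §2 `localization_kolyvaginClass_mem_stringentFamily_of_GZ31_of_irreducible`: C3's statement with
`hρ ↦ hirr + hpN` and `hGZ` GUARDED likewise, VERBATIM otherwise. CONSEQUENCE (sequel files): the `h49str` binder of the irreducible local-facts
line is fed IN FRAME, so the gaps stub of 20165 / 19941 becomes NAMED PRINT ONLY: {`hPT` Poitou–Tate, `hGZ` [GZ86 III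
(3.1)]} (+ the reading `h44I`). HONEST FRAMING: conditional on `hGZ`/`hcop′`/CM facts as displayed; nothing asserted
about any curve; 20165, 19941, their stubs and BSD stay open.

References: [cite: Jetchev2008, Def. 4.8, Prop. 4.9 (arXiv) = Prop. 4.1 (pp. 819–821); §3.1 (p. 814)]
[cite: GrossLMS1991, §4 Lemma 4.3, §6 Prop. 6.2 (1)] [cite: GrossZagier1986, III (3.1)] [cite: MilneADT2006, Ch. I Prop. 3.8]
[cite: SilvermanAEC2009, VII.1.3(b), VII.2 Prop. 2.1].
-/

set_option autoImplicit false
-- the Theorems directory repeats the summit name (sibling precedent `KatoDescentPotSupersingularAssembly.lean`)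
set_option linter.dupNamespace false

noncomputable section

open scoped Classical
open WeierstrassCurve Field NumberField IsDedekindDomain Finset
open Literature.NumberTheory.EllipticCurves Literature.NumberTheory.GaloisRepresentations
open Literature.NumberTheory.EllipticCurves.KolyvaginCocycle Literature.NumberTheory.EllipticCurves.KolyvaginEuler
open Literature.NumberTheory.EllipticCurves.RingClassField Literature.NumberTheory.EllipticCurves.ModularForms
open Summit.BirchSwinnertonDyer.Rank1Residual.X11b Summit.BirchSwinnertonDyer.Rank1Residual.X11b.Three
open Summit.BirchSwinnertonDyer.Rank1Residual.X11b.Three.GrossBadPlace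
open Summit.BirchSwinnertonDyer.Rank1Residual.X11b.KolyvaginHloc
open Summit.BirchSwinnertonDyer.Rank1Residual.JET
open Summit.BirchSwinnertonDyer.BirchSwinnertonDyer.Theorems

namespace Summit.BirchSwinnertonDyer.BirchSwinnertonDyer.Theorems.JetchevIrreducibleStringent

-- `K : Type`: the tree's ring-class class field theory is universe `0`.
variable {K : Type} [Field K] [NumberField K] {W : WeierstrassCurve ℚ}

/-! ### §1 The Kummer membership of `c_k(c)` on an irreducible row, `hGZ` GUARDED by the Kolyvagin scope -/

/-- **`loc_v c_k(c) ∈ H¹_Kum(K_v, E[p^k])` at every place `v` NOT over a prime factor of `c`, for `E[p]` IRREDUCIBLE, `p ∣ N_E`,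
with [GZ86 III (3.1)] displayed in the GUARDED receptacle shape** (`∀ m` square-free with Zhang–Kolyvagin prime factors — Gross's
printed scope «n ≥ 1 prime to N», read-1's `HGZKolyvagin`): k8t-c4 g8's
`JetchevIrreducibleReadingThm52Bricks.localization_kolyvaginClass_mem_kummerSelmerStructure_of_GZ31_of_irreducible` (p507503) byte-for-byte,
the schema being consumed at the divisors of the Kolyvagin conductor `c` only. [cite: GrossLMS1991, §6 Prop. 6.2 (1); §3 (3.1)]
[cite: GrossZagier1986, III (3.1)] [cite: Jetchev2008, Prop. 4.6 (p. 820)] -/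
theorem localization_kolyvaginClass_mem_kummerSelmerStructure_of_GZ31_of_irreducible_kolyvagin [W.IsElliptic]
    [W.IsGloballyMinimal] [NeZero (W.conductorNorm ℤ)]
    (hCM1 : phi_heegnerPointOfConductor_mem_range_map_ringClassField (W.conductorNorm ℤ) W K)
    (hCM2 : exists_generator_ringClassGalOver K)
    (hK : IsImaginaryQuadratic K) (hD3 : NumberField.discr K ≠ -3) (hD4 : NumberField.discr K ≠ -4)
    (hH : SatisfiesHeegnerHypothesis (W.conductorNorm ℤ) K)
    {p : ℕ} [Fact p.Prime] (hp2 : p ≠ 2) (hirr : W.HasIrreducibleModPGaloisRep p)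
    (hpN : p ∣ W.conductorNorm ℤ)
    (Dt : ModularParametrizationData W (W.conductorNorm ℤ)) (β : ℤ) (ι : K →+* ℂ)
    {n' : ℤ} (hcop' : IsCoprime (p : ℤ) n')
    (hGZ : ∀ (m : ℕ), Squarefree m →
      (∀ q ∈ m.primeFactors, Zhang2014.IsKolyvaginPrime (W.conductorNorm ℤ) W K p q) →
      ∀ (dm : KolyvaginHeegnerData Dt β ι m)
      (γ : ringClassField K ι m ≃ₐ[ℚ] ringClassField K ι m), γ ∈ ringClassGal ι m →
      ∀ v : HeightOneSpectrum (𝓞 K), ¬ (W.baseChange K).HasGoodReductionAt v →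
        n' • pointsMap (W.baseChange K) (v.adicCompletion K)
            (dm.toGeomPoints (pointGalHom W (ringClassField K ι m) γ dm.y)) ∈
          E0Receptacle (W.baseChange K) v ∧
        ∀ (ℓ : ℕ), ℓ ∈ m.primeFactors → ∀ (dm' : KolyvaginHeegnerData Dt β ι (m / ℓ))
          (hle : ringClassField K ι (m / ℓ) ≤ ringClassField K ι m),
          n' • pointsMap (W.baseChange K) (v.adicCompletion K)
              (dm.toGeomPoints (pointGalHom W (ringClassField K ι m) γ
                (WeierstrassCurve.Affine.Point.map (W' := W)
                  ((RingClassField.inclusion ι hle).restrictScalars ℚ) dm'.y))) ∈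
            E0Receptacle (W.baseChange K) v)
    {c : ℕ} (hc : Squarefree c) {k : ℕ}
    (hcK : ∀ ℓ ∈ c.primeFactors, Zhang2014.IsKolyvaginPrime (W.conductorNorm ℤ) W K p ℓ ∧
      k ≤ Zhang2014.kolyvaginIndex W p ℓ)
    (d : KolyvaginHeegnerData Dt β ι c) [∀ j : ℕ, NumberField (ringClassField K ι j)]
    (v : Place K) (hv : ∀ ℓ ∈ c.primeFactors, ¬ Jetchev2008.PlaceOver K v ℓ) :
    galoisCohomology.localization ((W.baseChange K).torsionGaloisModule ((p ^ k : ℕ) : ℤ)) v 1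
        (d.kolyvaginClass (Fact.out : p.Prime) k) ∈
      (W.baseChange K).kummerSelmerStructure ((p ^ k : ℕ) : ℤ) v := by
  have hp : p.Prime := Fact.out
  rcases v with w | 𝔳
  · -- complex place: `H¹(ℂ, ·) = 0`
    haveI : IsTotallyComplex K := hK.2
    have hw : w.IsComplex := IsTotallyComplex.isComplex w
    have htop := GlobalDuality.addSubgroup_galoisCohomology_inl_eq_top_of_isComplex
      ((W.baseChange K).torsionGaloisModule ((p ^ k : ℕ) : ℤ)) hw
      ((W.baseChange K).kummerSelmerStructure ((p ^ k : ℕ) : ℤ) (Sum.inl w))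
    rw [htop]
    exact AddSubgroup.mem_top _
  · -- finite place `𝔳 ∤ c`
    have hcv : (c : 𝓞 K) ∉ 𝔳.asIdeal := fun h ↦ by
      obtain ⟨ℓ, hℓ, hℓv⟩ := exists_primeFactor_mem_of_natCast_mem hc 𝔳 h
      exact hv ℓ hℓ ⟨𝔳, rfl, hℓv⟩
    have hND : IsCoprime (W.conductorNorm ℤ : ℤ) (NumberField.discr K) :=
      KolyvaginAssembly.isCoprime_discr_of_satisfiesHeegnerHypothesis hK hH
    have hD : NumberField.discr K < -4 := KolyvaginAssembly.discr_lt_neg_four hK ⟨hD3, hD4⟩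
    have hinert : ∀ (m' : ℕ), m' ∣ c → ∀ q ∈ m'.primeFactors, (Ideal.span {(q : 𝓞 K)}).IsPrime :=
      fun m' hm' q hq ↦ (hcK q (Nat.primeFactors_mono hm' hc.ne_zero hq)).1.2.2.2.2.1
    -- data at every divisor of `c` (the given `d` at `c` itself)
    have hne : ∀ m' : ℕ, m' ∣ c → Nonempty (KolyvaginHeegnerData Dt β ι m') := fun m' hm' ↦
      BirchSwinnertonDyer.Theorems.nonempty_kolyvaginHeegnerData_of_grossCM hCM1 hCM2 hK hH Dt β ι
        d.dvd_sq_sub (hc.squarefree_of_dvd hm') (hinert m' hm')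
    let data : (m' : ℕ) → m' ∣ c → KolyvaginHeegnerData Dt β ι m' := fun m' hm' ↦
      if h : m' = c then h ▸ d else (hne m' hm').some
    have hdata : data c dvd_rfl = d := by simp [data]
    -- the Kolyvagin guard at every divisor of `c`
    have hkol : ∀ (m : ℕ), m ∣ c → ∀ q ∈ m.primeFactors,
        Zhang2014.IsKolyvaginPrime (W.conductorNorm ℤ) W K p q := fun m hm q hq ↦
      (hcK q (Nat.primeFactors_mono hm hc.ne_zero hq)).1
    have hcop : IsCoprime ((p ^ k : ℕ) : ℤ) n' := by
      rw [Nat.cast_pow]; exact IsCoprime.pow_left hcop'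
    have h := hloc_concrete_of_GZ31_zhang hK ι hp Dt hND hD hc hcK data hcop
      (fun m hm γ hγ v hbad ↦ ⟨(hGZ m (hc.squarefree_of_dvd hm) (hkol m hm) (data m hm) γ hγ v hbad).1,
        fun ℓ hℓ hle ↦ (hGZ m (hc.squarefree_of_dvd hm) (hkol m hm) (data m hm) γ hγ v hbad).2 ℓ hℓ _ hle⟩)
      (fun m hm ↦ JetchevIrreducibleReadingThm52Bricks.isAdmissible_of_irreducible_of_dvd_conductorNorm hK hH hp hp2
        hirr hpN hc hcK data m hm)
      c dvd_rfl 𝔳 hcv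
    rw [hdata] at h
    rw [← AddSubgroup.mem_comap, (W.baseChange K).comap_localization_kummerSelmerStructure]
    exact h


/-! ### §2 Jetchev Prop. 4.9 proper on an irreducible row -/

/-- **K-GAP-2 `h49str` in the `H63` binder currency: `loc_v c_k(c) ∈ 𝒮_v` at EVERY place `v ∤ c`**
(`𝒮 = JET.stringentFamily W K hn`, Jetchev's stringent Kummer structure of Def. 4.8 / §3.1 read on
x11b3's connected Kummer condition). IRREDUCIBLE PORT (seat `bsd-potss-k9-c4` g9) of bsd-jet pv-1 g7's
`JET.localization_kolyvaginClass_mem_stringentFamily_of_GZ31` (p532810, `Rank1ResidualJetKolyvaginClassStringent`): `hρ` (mod-`p`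
surjectivity) ↦ `hirr` + `hpN` (`E[p]` irreducible, `p ∣ N_E`), used only through the admissibility of `E(K[m])` mod `p^k`
(k8t-c4 g8 `isAdmissible_of_irreducible_of_dvd_conductorNorm`) and the Kummer membership
(`localization_kolyvaginClass_mem_kummerSelmerStructure_of_GZ31_of_irreducible`); everything else byte-for-byte.
For `E/ℚ` globally minimal with `E[p]` irreducible at an odd `p ∣ N_E`,
`K` imaginary quadratic with `d_K ∉ {−3, −4}` and the Heegner hypothesis for `N = N_E`, a frame
`(Dt, β, ι)`, `c ∈ Λ` with prime factors of index `≥ k`, ANY datum `d` of conductor `c`, and a place `v`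
not over a prime factor of `c`: complex `v` — `H¹(ℂ, ·) = 0`; finite `v` with non-minimal base change —
`𝒮_v = Kum_v` by definition; finite good `v` with minimal base change — `Kum⁰ = Kum` (`E₀ = E`);
these three by pv-2's `localization_kolyvaginClass_mem_kummerSelmerStructure_of_GZ31`; finite BAD `v`
with minimal base change — the stringent chain (`…_concrete_of_GZ31_zhang` above, then
`Receptacle.mem_goodReductionSubgroup_of_mem_E0Receptacle`). GIVEN: `hGZ` = [GZ86 III (3.1)] in the
GUARDED receptacle form (square-free Kolyvagin conductors only), `n′` prime to `p`, the two Gross §3 CM facts (data at the divisors of `c`).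
[cite: Jetchev2008, Def. 4.8, Prop. 4.9; §3.1 (p. 814)] [cite: GrossLMS1991, §6 Prop. 6.2 (1)]
[cite: GrossZagier1986, III (3.1)] -/
theorem localization_kolyvaginClass_mem_stringentFamily_of_GZ31_of_irreducible [W.IsElliptic] [W.IsGloballyMinimal]
    [NeZero (W.conductorNorm ℤ)]
    (hCM1 : phi_heegnerPointOfConductor_mem_range_map_ringClassField (W.conductorNorm ℤ) W K)
    (hCM2 : exists_generator_ringClassGalOver K)
    (hK : IsImaginaryQuadratic K) (hD3 : NumberField.discr K ≠ -3) (hD4 : NumberField.discr K ≠ -4)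
    (hH : SatisfiesHeegnerHypothesis (W.conductorNorm ℤ) K)
    {p : ℕ} [Fact p.Prime] (hp2 : p ≠ 2) (hirr : W.HasIrreducibleModPGaloisRep p)
    (hpN : p ∣ W.conductorNorm ℤ)
    (Dt : ModularParametrizationData W (W.conductorNorm ℤ)) (β : ℤ) (ι : K →+* ℂ)
    {n' : ℤ} (hcop' : IsCoprime (p : ℤ) n')
    (hGZ : ∀ (m : ℕ), Squarefree m →
      (∀ q ∈ m.primeFactors, Zhang2014.IsKolyvaginPrime (W.conductorNorm ℤ) W K p q) →
      ∀ (dm : KolyvaginHeegnerData Dt β ι m)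
      (γ : ringClassField K ι m ≃ₐ[ℚ] ringClassField K ι m), γ ∈ ringClassGal ι m →
      ∀ v : HeightOneSpectrum (𝓞 K), ¬ (W.baseChange K).HasGoodReductionAt v →
        n' • pointsMap (W.baseChange K) (v.adicCompletion K)
            (dm.toGeomPoints (pointGalHom W (ringClassField K ι m) γ dm.y)) ∈
          E0Receptacle (W.baseChange K) v ∧
        ∀ (ℓ : ℕ), ℓ ∈ m.primeFactors → ∀ (dm' : KolyvaginHeegnerData Dt β ι (m / ℓ))
          (hle : ringClassField K ι (m / ℓ) ≤ ringClassField K ι m),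
          n' • pointsMap (W.baseChange K) (v.adicCompletion K)
              (dm.toGeomPoints (pointGalHom W (ringClassField K ι m) γ
                (WeierstrassCurve.Affine.Point.map (W' := W)
                  ((RingClassField.inclusion ι hle).restrictScalars ℚ) dm'.y))) ∈
            E0Receptacle (W.baseChange K) v)
    {c : ℕ} (hc : Squarefree c) {k : ℕ} (hn : ((p ^ k : ℕ) : ℤ) ≠ 0)
    (hcK : ∀ ℓ ∈ c.primeFactors, Zhang2014.IsKolyvaginPrime (W.conductorNorm ℤ) W K p ℓ ∧
      k ≤ Zhang2014.kolyvaginIndex W p ℓ)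
    (d : KolyvaginHeegnerData Dt β ι c) [∀ j : ℕ, NumberField (ringClassField K ι j)]
    (v : Place K) (hv : ∀ ℓ ∈ c.primeFactors, ¬ Jetchev2008.PlaceOver K v ℓ) :
    galoisCohomology.localization ((W.baseChange K).torsionGaloisModule ((p ^ k : ℕ) : ℤ)) v 1
        (d.kolyvaginClass (Fact.out : p.Prime) k) ∈ stringentFamily W K hn v := by
  have hp : p.Prime := Fact.out
  -- the Kummer condition at `v` (pv-2), used at complex / non-minimal / good places
  have hKum := localization_kolyvaginClass_mem_kummerSelmerStructure_of_GZ31_of_irreducible_kolyvagin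
    hCM1 hCM2 hK hD3 hD4 hH hp2 hirr hpN Dt β ι hcop' hGZ hc hcK d v hv
  rcases v with w | 𝔳
  · -- complex place: the stringent family IS the Kummer condition there
    exact hKum
  · by_cases hmin : ((W.baseChange K).baseChange (𝔳.adicCompletion K)).IsMinimal (𝔳.adicCompletionIntegers K)
    swap
    · -- non-minimal base change: `𝒮_v = Kum_v` by definition
      rw [show stringentFamily W K hn (Sum.inr 𝔳) =
          (W.baseChange K).kummerSelmerStructure ((p ^ k : ℕ) : ℤ) (Sum.inr 𝔳) by
        simp only [stringentFamily, dif_neg hmin]]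
      exact hKum
    haveI := hmin
    haveI : CharZero (𝔳.adicCompletion K) :=
      charZero_of_injective_algebraMap (algebraMap K _).injective
    rw [stringentFamily_inr_of_isMinimal W K hn 𝔳]
    by_cases hgood : (W.baseChange K).HasGoodReductionAt 𝔳
    · -- good minimal place: `E₀(K_v) = E(K_v)`, so `Kum⁰ = Kum`
      haveI : ((W.baseChange K).baseChange (𝔳.adicCompletion K)).HasGoodReduction
          (𝔳.adicCompletionIntegers K) :=
        (hasGoodReduction_iff_of_isMinimal_of_eq_smul (𝔳.adicCompletionIntegers K)
          (rfl : (W.baseChange K).localMinimalModel 𝔳 =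
            (((W.baseChange K).baseChange (𝔳.adicCompletion K)).exists_isMinimal
              (𝔳.adicCompletionIntegers K)).choose • (W.baseChange K).baseChange (𝔳.adicCompletion K))).mp
          hgood
      rw [Summit.BirchSwinnertonDyer.Rank1Residual.X11b.Three.JetchevKummer.connectedKummerCondition_eq_of_goodReductionSubgroup_eq_top
        (W.baseChange K) (𝔳.adicCompletion K) (𝔳.adicCompletionIntegers K) hn
        (WeierstrassCurve.goodReductionSubgroup_eq_top_of_hasGoodReduction
          (𝔳.adicCompletionIntegers K) _)]
      rw [WeierstrassCurve.kummerSelmerStructure_apply] at hKum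
      exact hKum
    -- BAD minimal place: the stringent chain
    have hcv : (c : 𝓞 K) ∉ 𝔳.asIdeal := fun h ↦ by
      obtain ⟨ℓ, hℓ, hℓv⟩ := exists_primeFactor_mem_of_natCast_mem hc 𝔳 h
      exact hv ℓ hℓ ⟨𝔳, rfl, hℓv⟩
    have hND : IsCoprime (W.conductorNorm ℤ : ℤ) (NumberField.discr K) :=
      KolyvaginAssembly.isCoprime_discr_of_satisfiesHeegnerHypothesis hK hH
    have hD : NumberField.discr K < -4 := KolyvaginAssembly.discr_lt_neg_four hK ⟨hD3, hD4⟩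
    have hinert : ∀ (m' : ℕ), m' ∣ c → ∀ q ∈ m'.primeFactors, (Ideal.span {(q : 𝓞 K)}).IsPrime :=
      fun m' hm' q hq ↦ (hcK q (Nat.primeFactors_mono hm' hc.ne_zero hq)).1.2.2.2.2.1
    -- data at every divisor of `c` (the given `d` at `c` itself)
    have hne : ∀ m' : ℕ, m' ∣ c → Nonempty (KolyvaginHeegnerData Dt β ι m') := fun m' hm' ↦
      BirchSwinnertonDyer.Theorems.nonempty_kolyvaginHeegnerData_of_grossCM hCM1 hCM2 hK hH Dt β ι
        d.dvd_sq_sub (hc.squarefree_of_dvd hm') (hinert m' hm')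
    let data : (m' : ℕ) → m' ∣ c → KolyvaginHeegnerData Dt β ι m' := fun m' hm' ↦
      if h : m' = c then h ▸ d else (hne m' hm').some
    have hdata : data c dvd_rfl = d := by simp [data]
    -- the Kolyvagin guard at every divisor of `c`
    have hkol : ∀ (m : ℕ), m ∣ c → ∀ q ∈ m.primeFactors,
        Zhang2014.IsKolyvaginPrime (W.conductorNorm ℤ) W K p q := fun m hm q hq ↦
      (hcK q (Nat.primeFactors_mono hm hc.ne_zero hq)).1
    have hcop : IsCoprime ((p ^ k : ℕ) : ℤ) n' := by
      rw [Nat.cast_pow]; exact IsCoprime.pow_left hcop'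
    obtain ⟨t, htE, ht⟩ := exists_localKummerMap_eq_res_kolyvaginClass_concrete_of_GZ31_zhang hK ι hp Dt
      hND hD hc hcK data hcop
      (fun m hm γ hγ v hbad ↦ ⟨(hGZ m (hc.squarefree_of_dvd hm) (hkol m hm) (data m hm) γ hγ v hbad).1,
        fun ℓ hℓ hle ↦ (hGZ m (hc.squarefree_of_dvd hm) (hkol m hm) (data m hm) γ hγ v hbad).2 ℓ hℓ _ hle⟩)
      (fun m hm ↦ JetchevIrreducibleReadingThm52Bricks.isAdmissible_of_irreducible_of_dvd_conductorNorm hK hH hp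
        hp2 hirr hpN hc hcK data m hm) hn c dvd_rfl 𝔳 hcv hgood
    rw [hdata] at ht
    -- `e(t) ∈ E⁰(K̄_v)` and `t` rational ⇒ `t ∈ E₀(K_v)` (B); `loc_v c = δ_v(t)`
    exact (Summit.BirchSwinnertonDyer.Rank1Residual.X11b.Three.JetchevKummer.mem_connectedKummerCondition_iff (W.baseChange K) (𝔳.adicCompletion K)
      (𝔳.adicCompletionIntegers K) hn _).mpr
      ⟨t, Receptacle.mem_goodReductionSubgroup_of_mem_E0Receptacle (W.baseChange K) 𝔳 t htE, ht⟩


end Summit.BirchSwinnertonDyer.BirchSwinnertonDyer.Theorems.JetchevIrreducibleStringent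

end
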